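import Literature.Probability.Percolation.HierarchicalDecomposition
import Literature.Probability.Percolation.LongRangeKernelPercolationProofs
import Literature.Probability.LatticeModels.ProdBernoulliSuperposition
import HarnessLib

/-!
# Hierarchical long-range percolation: the joint law `P_{β,σ}`, the configurations `η_B`, and (2.4)

Topic `Literature/Probability/Percolation`. Second part of the skeleton of Hutchcroft 2022, §2.1
(for the named fact `Hutchcroft2022_twoPoint_volumeTail`): the probabilistic coupling
"Let `ω_R` be long-range Bernoulli percolation on `ℤ^d` with kernel `R_σ` … and for each
non-singleton block `B` let `ω_B` be a long-range Bernoulli percolation configuration … with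
kernel `H_B`, where the `ω_B` are all independent of each other and of `ω_R`. The union `ω` … is
equal in distribution to long-range Bernoulli percolation on `ℤ^d` with kernel `J`, and we write
`P_{β,σ}` for the joint law", the configurations
`η_B := ω_R ∪ ⋃ {ω_{B'} : B' not an ancestor of B}` "distributed as long-range Bernoulli percolation
with kernel `J_{σ,B}`", and the renormalisation identity (2.4) `η_{σ(B)} = η_B ∪ ω_{σ(B)}`.

Design: `P_{β,σ}` is ONE product Bernoulli measure `hierLaw` on labelled pairs
`Sym2 (ℤ^d) × {0,1}` (layer `0` = the remainder copies with kernel `R_σ`, layer `1` = the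
hierarchical copies with kernel `H_σ`; the `ω_B` are the restrictions of layer `1` to the pairwise
disjoint sets `blockEdges` of pairs of each block, hence automatically independent), and
`ω_R`, `ω_B`, `η_B`, `ω` are deterministic maps of the labelled configuration (`etaCfg`,
`omegaLayer`), so that independence, Harris–FKG and BK are available on the labelled space.

* `prodBernoulli_map_inter` — thinning a product Bernoulli configuration by a fixed coordinate set;
  `symm_symm_mul_symm_kernelEdgeProb` — `1 - (1-p_{J₁})(1-p_{J₂}) = p_{J₁+J₂}`;
* `hierParam`, `hierLaw` (`P_{β,σ}`), `etaCfg A` (`ω_R ∪ {hierarchical copies in A}`),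
  **`hierLaw_map_etaCfg`**: the law of `etaCfg A` is `kernelPercolation (𝟙_A J + 𝟙_{Aᶜ} R_σ) β`
  (for `A = aboveFree B` this is the law `J_{σ,B}` of `η_B`; for `A = univ` the law `J` of `ω`,
  `hierLaw_map_etaCfg_univ`);
* `IsProperEdge`, `edgeBlock`, `edgeLevel`, `aboveFree B` (pairs whose block is not a strict ancestor
  of `B`), `blockEdges n x` (pairs of `B_n(x)`), `omegaLayer` (`ω_B`), `level_eq_of_block_eq`,
  `level_le_of_block_subset`, **`mem_aboveFree_succ_iff`** and **`etaCfg_aboveFree_succ`** ((2.4)).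

## References

* [Hutchcroft2022] T. Hutchcroft, J. Math. Phys. 63 (2022), arXiv:2202.07634, §2.1 (p. 7):
  `P_{β,σ}`, `η_B`, `J_{σ,B}`, (2.4), (2.5).
-/

noncomputable section

namespace Literature.Probability.Percolation

open Finset Literature.Probability.LatticeModels

variable {d : ℕ}


section LabelledLaw

open MeasureTheory unitInterval

variable {ι : Type*}

/-- **Deterministic thinning of a product Bernoulli configuration**: intersecting with a fixed set
`D` of coordinates yields a product Bernoulli configuration with the parameters switched off
outside `D`. [folklore] -/
theorem prodBernoulli_map_inter (p : ι → unitInterval) (D : Set ι) [DecidablePred (· ∈ D)] :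
    (prodBernoulli p).map (fun ξ : Set ι => ξ ∩ D) = prodBernoulli (fun i => if i ∈ D then p i else 0) := by
  classical
  have hf : ∀ i, Measurable (fun r : Prop => r ∧ i ∈ D) := fun i => measurable_of_countable _
  have hpi : Measurable (fun (q : ι → Prop) (i : ι) => q i ∧ i ∈ D) :=
    measurable_pi_lambda _ fun i => (hf i).comp (measurable_pi_apply i)
  have hset : Measurable (fun q : ι → Prop => {i | q i}) := measurable_setOf
  have hproj : Measurable (fun ξ : Set ι => ξ ∩ D) :=
    measurable_set_iff.2 fun i => (measurable_set_mem i).and measurable_const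
  have hcomp : (fun ξ : Set ι => ξ ∩ D) ∘ (fun q : ι → Prop => {k | q k}) =
      (fun q : ι → Prop => {i | q i}) ∘ (fun (q : ι → Prop) (i : ι) => q i ∧ i ∈ D) := by
    funext q; ext i; simp
  rw [prodBernoulli_eq_map p, Measure.map_map hproj measurable_setOf, hcomp,
    ← Measure.map_map hset hpi]
  have hpush : (Measure.infinitePi fun i : ι =>
      (toNNReal (p i) • Measure.dirac True + toNNReal (σ (p i)) • Measure.dirac False : Measure Prop)).map
        (fun (q : ι → Prop) (i : ι) => q i ∧ i ∈ D) =
      Measure.infinitePi fun i : ι => ((toNNReal (p i) • Measure.dirac True +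
        toNNReal (σ (p i)) • Measure.dirac False : Measure Prop)).map (fun r : Prop => r ∧ i ∈ D) :=
    Measure.infinitePi_map_pi _ hf
  rw [hpush, prodBernoulli_eq_map]
  congr 1
  congrm Measure.infinitePi fun i => ?_
  -- the one-coordinate computation
  haveI : IsProbabilityMeasure (((toNNReal (p i) • Measure.dirac True +
      toNNReal (σ (p i)) • Measure.dirac False : Measure Prop)).map (fun r : Prop => r ∧ i ∈ D)) :=
    Measure.isProbabilityMeasure_map (hf i).aemeasurable
  by_cases hi : i ∈ D
  · have : (fun r : Prop => r ∧ i ∈ D) = id := by funext r; simp [hi]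
    rw [this, Measure.map_id, if_pos hi]
  · rw [if_neg hi]
    refine Measure.ext_of_singleton fun a => ?_
    rw [Measure.map_apply (hf i) (measurableSet_singleton a)]
    have hpre : (fun r : Prop => r ∧ i ∈ D) ⁻¹' {a} = if a then ∅ else Set.univ := by
      ext r; by_cases ha : a <;> simp [ha, hi]
    rcases Classical.em a with ha | ha
    · obtain rfl : a = True := eq_true ha
      rw [hpre, if_pos trivial, measure_empty]
      show (0 : ENNReal) = (toNNReal (0 : unitInterval) • Measure.dirac True +
        toNNReal (σ (0 : unitInterval)) • Measure.dirac False : Measure Prop) {True}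
      simp
    · obtain rfl : a = False := eq_false ha
      rw [hpre, if_neg not_false, measure_univ]
      show (1 : ENNReal) = (toNNReal (0 : unitInterval) • Measure.dirac True +
        toNNReal (σ (0 : unitInterval)) • Measure.dirac False : Measure Prop) {False}
      simp

variable {d : ℕ}

/-- **Superposition of the edge probabilities**: `1 - (1 - p_{J₁})(1 - p_{J₂}) = p_{J₁+J₂}` for
`p_J = 1 - e^{-βJ}`, `β, J₁, J₂ ≥ 0` ("the union … is equal in distribution to long-range Bernoulli
percolation … with kernel `J`"). [cite: Hutchcroft2022, §2.1 (p. 7)] -/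
theorem symm_symm_mul_symm_kernelEdgeProb {J₁ J₂ : Sym2 (Site d) → ℝ} {β : ℝ} (hβ : 0 ≤ β)
    {e : Sym2 (Site d)} (h₁ : 0 ≤ J₁ e) (h₂ : 0 ≤ J₂ e) :
    σ (σ (kernelEdgeProb J₁ β e) * σ (kernelEdgeProb J₂ β e)) = kernelEdgeProb (fun e => J₁ e + J₂ e) β e := by
  apply Subtype.ext
  rw [coe_symm_symm_mul_symm, coe_kernelEdgeProb (mul_nonneg hβ h₁), coe_kernelEdgeProb (mul_nonneg hβ h₂),
    coe_kernelEdgeProb (mul_nonneg hβ (add_nonneg h₁ h₂))]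
  rw [mul_add, neg_add, Real.exp_add]
  ring

/-- The edge probability only depends on the kernel's value at the edge. [folklore] -/
theorem kernelEdgeProb_congr {K K' : Sym2 (Site d) → ℝ} {e : Sym2 (Site d)} (h : K e = K' e) (β : ℝ) :
    kernelEdgeProb K β e = kernelEdgeProb K' β e := by
  unfold kernelEdgeProb; rw [h]

/-- With one layer switched off: `1 - (1 - p)(1 - 0) = p`. [folklore] -/
theorem symm_symm_mul_symm_zero (p : unitInterval) : σ (σ p * σ 0) = p := by
  apply Subtype.ext
  rw [coe_symm_symm_mul_symm]
  simp

variable {L : ℕ}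

/-- **The parameters of the joint law `P_{β,σ}`**: layer `0` carries the remainder kernel `R_σ`,
layer `1` the hierarchical kernel `H_σ` (all the `ω_B` at once, block by block on disjoint
coordinate sets). [cite: Hutchcroft2022, §2.1 (p. 7, P_{β,σ})] -/
def hierParam (J : Sym2 (Site d) → ℝ) (L : ℕ) (o : ℕ → Site d) (c α β : ℝ) :
    Sym2 (Site d) × Fin 2 → unitInterval :=
  fun k => kernelEdgeProb (if k.2 = 0 then remKernel J L o c α else hierKernel L o c α) β k.1

/-- **The joint law `P_{β,σ}`** of `ω_R` (layer `0`) and all the `ω_B` (layer `1`), realised as ONE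
product Bernoulli measure on the labelled pairs `Sym2 (ℤ^d) × {0,1}`.
[cite: Hutchcroft2022, §2.1 (p. 7, "we write P_{β,σ} for the joint law of ω_R and ((ω_B)_B)_n")] -/
def hierLaw (J : Sym2 (Site d) → ℝ) (L : ℕ) (o : ℕ → Site d) (c α β : ℝ) :
    Measure (Set (Sym2 (Site d) × Fin 2)) :=
  prodBernoulli (hierParam J L o c α β)

/-- `P_{β,σ}` is a probability measure. [folklore] -/
instance instIsProbabilityMeasureHierLaw (J : Sym2 (Site d) → ℝ) (L : ℕ) (o : ℕ → Site d)
    (c α β : ℝ) : IsProbabilityMeasure (hierLaw J L o c α β) := by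
  unfold hierLaw; infer_instance

/-- **The configuration `η_A = ω_R ∪ ⋃ {ω_B : edges of B in A}`** built from the labelled
configuration `ξ`: an edge is open iff its remainder copy is open, or its hierarchical copy is open
and the edge belongs to the selection `A` (for `η_B`, `A` = pairs whose block is not an ancestor of
`B`; for the full configuration `ω`, `A = univ`). [cite: Hutchcroft2022, §2.1 (p. 7, η_B)] -/
def etaCfg (A : Set (Sym2 (Site d))) (ξ : Set (Sym2 (Site d) × Fin 2)) : BondConfig (Site d) :=
  {e | (e, (0 : Fin 2)) ∈ ξ ∨ ((e, (1 : Fin 2)) ∈ ξ ∧ e ∈ A)}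

/-- `etaCfg A` is measurable. [folklore] -/
theorem measurable_etaCfg (A : Set (Sym2 (Site d))) : Measurable (etaCfg (d := d) A) := by
  refine measurable_set_iff.2 fun e => ?_
  exact (measurable_set_mem (e, (0 : Fin 2))).or ((measurable_set_mem (e, (1 : Fin 2))).and
    measurable_const)

/-- `etaCfg A` factors through thinning by `D = (univ × {0}) ∪ (A × {1})` and superposition. [folklore] -/
theorem etaCfg_eq_superpose_inter (A : Set (Sym2 (Site d))) :
    etaCfg (d := d) A = (fun ξ : Set (Sym2 (Site d) × Fin 2) => {e | (e, (0 : Fin 2)) ∈ ξ ∨ (e, (1 : Fin 2)) ∈ ξ}) ∘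
      fun ξ => ξ ∩ {k | k.2 = 0 ∨ k.1 ∈ A} := by
  funext ξ
  ext e
  simp [etaCfg]

/-- **The law of `η_A` under `P_{β,σ}` is long-range percolation with kernel `R_σ + H_σ 𝟙_A`**, i.e.
with edge weight `J_e` on `A` and `R_σ(e)` off `A` (Hutchcroft 2022, p. 7: `η_B` "is distributed as
long-range Bernoulli percolation with kernel `J_{σ,B}(x,y) := R_σ(x,y) + Σ H_{B'}(x,y) 𝟙(B' not an
ancestor of B)`"). [cite: Hutchcroft2022, §2.1 (p. 7, law of η_B)] -/
theorem hierLaw_map_etaCfg (hL : 1 ≤ L) {o : ℕ → Site d} (ho : IsHierOffset L o)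
    {J : Sym2 (Site d) → ℝ} {c α β : ℝ} (hc : 0 ≤ c) (hα : 0 ≤ (d : ℝ) + α) (hJ0 : ∀ e, 0 ≤ J e)
    (hJ : HasPowerLowerBound J c α) (hβ : 0 ≤ β) (A : Set (Sym2 (Site d))) [DecidablePred (· ∈ A)] :
    (hierLaw J L o c α β).map (etaCfg A) =
      kernelPercolation (fun e => if e ∈ A then J e else remKernel J L o c α e) β := by
  classical
  have hR : ∀ e, 0 ≤ remKernel J L o c α e := remKernel_nonneg hL ho hc hα hJ0 hJ
  have hH : ∀ e, 0 ≤ hierKernel L o c α e := hierKernel_nonneg hc α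
  have hthin : Measurable (fun ξ : Set (Sym2 (Site d) × Fin 2) => ξ ∩ {k | k.2 = 0 ∨ k.1 ∈ A}) :=
    measurable_set_iff.2 fun k => (measurable_set_mem k).and measurable_const
  have hsup : Measurable (fun ξ : Set (Sym2 (Site d) × Fin 2) =>
      {e | (e, (0 : Fin 2)) ∈ ξ ∨ (e, (1 : Fin 2)) ∈ ξ}) :=
    measurable_set_iff.2 fun e => (measurable_set_mem (e, (0 : Fin 2))).or (measurable_set_mem (e, (1 : Fin 2)))
  rw [etaCfg_eq_superpose_inter, ← Measure.map_map hsup hthin, hierLaw, prodBernoulli_map_inter,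
    prodBernoulli_map_superpose, kernelPercolation]
  congr 1
  funext e
  simp only [hierParam, Set.mem_setOf_eq, Fin.isValue, true_or, if_true, one_ne_zero, false_or,
    if_false]
  by_cases he : e ∈ A
  · rw [if_pos he, symm_symm_mul_symm_kernelEdgeProb hβ (hR e) (hH e)]
    refine kernelEdgeProb_congr ?_ β
    rw [if_pos he, add_comm]
    exact hierKernel_add_remKernel J L o c α e
  · rw [if_neg he, symm_symm_mul_symm_zero]
    exact kernelEdgeProb_congr (by rw [if_neg he]) β

/-- **The full configuration `ω = ω_R ∪ ⋃_B ω_B` is long-range percolation with kernel `J`**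
("The union `ω` of the configuration `ω_R` with all of the configurations `ω_B` is equal in
distribution to long-range Bernoulli percolation on `ℤ^d` with kernel `J`").
[cite: Hutchcroft2022, §2.1 (p. 7)] -/
theorem hierLaw_map_etaCfg_univ (hL : 1 ≤ L) {o : ℕ → Site d} (ho : IsHierOffset L o)
    {J : Sym2 (Site d) → ℝ} {c α β : ℝ} (hc : 0 ≤ c) (hα : 0 ≤ (d : ℝ) + α) (hJ0 : ∀ e, 0 ≤ J e)
    (hJ : HasPowerLowerBound J c α) (hβ : 0 ≤ β) :
    (hierLaw J L o c α β).map (etaCfg Set.univ) = kernelPercolation J β := by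
  rw [hierLaw_map_etaCfg hL ho hc hα hJ0 hJ hβ]
  simp

end LabelledLaw

/-! ### Proper edges, their blocks, and the selections `A_B` -/

section EdgeBlocks

variable {L : ℕ} (hL : 2 ≤ L) {o : ℕ → Site d} (ho : IsHierOffset L o)

/-- A **proper** pair: two distinct points in a common block (the pairs charged by `H_σ`).
[cite: Hutchcroft2022, §2.1 (p. 6)] -/
def IsProperEdge (L : ℕ) (o : ℕ → Site d) (e : Sym2 (Site d)) : Prop :=
  Sym2.lift ⟨fun a b => a ≠ b ∧ (HasCommonBlock L o a b ∨ HasCommonBlock L o b a), by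
    intro a b; dsimp only; rw [ne_comm, or_comm]⟩ e

open Classical in
/-- **The block of a pair**: the `h_σ(a,b)`-block containing `a` and `b` (the unique block `B'`
with `H_{B'}(a,b) ≠ 0`); `∅` for improper pairs. [cite: Hutchcroft2022, §2.1 (p. 6, H_B)] -/
def edgeBlock (L : ℕ) (o : ℕ → Site d) (e : Sym2 (Site d)) : Finset (Site d) :=
  if IsProperEdge L o e then
    Sym2.lift ⟨fun a b => block L o (hLevelSym L o a b) a ∪ block L o (hLevelSym L o a b) b, by
      intro a b; dsimp only; rw [hLevelSym_comm, Finset.union_comm]⟩ e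
  else ∅

/-- The level of a pair, `h_σ(a,b)` (symmetrised). [cite: Hutchcroft2022, §2.1 (p. 6)] -/
def edgeLevel (L : ℕ) (o : ℕ → Site d) (e : Sym2 (Site d)) : ℕ :=
  Sym2.lift ⟨fun a b => hLevelSym L o a b, fun a b => hLevelSym_comm L o a b⟩ e

/-- **The selection `A_B` defining `η_B`**: pairs whose block is NOT a strict ancestor of `B`
("`B'` is not an ancestor of `B`", i.e. `B'` is contained in `B` or disjoint from `B`).
[cite: Hutchcroft2022, §2.1 (p. 7, η_B)] -/
def aboveFree (L : ℕ) (o : ℕ → Site d) (B : Finset (Site d)) : Set (Sym2 (Site d)) :=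
  {e | ¬(B ⊂ edgeBlock L o e)}

/-- **The pairs of the block `B_n(x)`** (those charged by `H_{B_n(x)}`): proper pairs whose block is
`B_n(x)` at level `n`. [cite: Hutchcroft2022, §2.1 (p. 6, H_B)] -/
def blockEdges (L : ℕ) (o : ℕ → Site d) (n : ℕ) (x : Site d) : Set (Sym2 (Site d)) :=
  {e | IsProperEdge L o e ∧ edgeBlock L o e = block L o n x ∧ edgeLevel L o e = n}

omit hL ho in
/-- `IsProperEdge` on a pair. [folklore] -/
theorem isProperEdge_mk {a b : Site d} :
    IsProperEdge L o s(a, b) ↔ a ≠ b ∧ (HasCommonBlock L o a b ∨ HasCommonBlock L o b a) := Iff.rfl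

include hL ho in
/-- For a proper pair `{a, b}`: `edgeBlock = B_{h(a,b)}(a) ∋ a, b`. [cite: Hutchcroft2022, §2.1 (p. 6)] -/
theorem edgeBlock_mk {a b : Site d} (h : IsProperEdge L o s(a, b)) :
    edgeBlock L o s(a, b) = block L o (hLevel L o a b) a := by
  have hL1 : 1 ≤ L := le_trans (by norm_num) hL
  obtain ⟨hab, hcommon⟩ := h
  have hc : HasCommonBlock L o a b := hcommon.elim id fun h' => h'.symm o hL1
  rw [edgeBlock, if_pos ⟨hab, hcommon⟩]
  simp only [Sym2.lift_mk, hLevelSym_eq hL1 ho]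
  have hb : b ∈ block L o (hLevel L o a b) a := mem_block_hLevel o hc
  rw [(block_eq_iff_mem hL1 o).2 hb, Finset.union_idempotent]

include hL ho in
/-- For a proper pair, `edgeLevel = h(a,b) ≥ 1`. [cite: Hutchcroft2022, §2.1 (p. 6)] -/
theorem edgeLevel_mk {a b : Site d} (h : IsProperEdge L o s(a, b)) :
    edgeLevel L o s(a, b) = hLevel L o a b ∧ 1 ≤ hLevel L o a b := by
  have hL1 : 1 ≤ L := le_trans (by norm_num) hL
  obtain ⟨hab, hcommon⟩ := h
  have hc : HasCommonBlock L o a b := hcommon.elim id fun h' => h'.symm o hL1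
  exact ⟨hLevelSym_eq hL1 ho a b, one_le_hLevel hL1 o hab hc⟩

include hL in
/-- **The level of a block is determined by the set** (`L ≥ 2`, `d ≥ 1`): `B_m(y) = B_n(x) ⇒ m = n`
(the cardinalities `L^{dm}`, `L^{dn}` agree). [cite: Hutchcroft2022, §2.1 (p. 6)] -/
theorem level_eq_of_block_eq (hd : 1 ≤ d) {m n : ℕ} {x y : Site d} (h : block L o m y = block L o n x) :
    m = n := by
  have := congr_arg Finset.card h
  rw [card_block o, card_block o, ← pow_mul, ← pow_mul] at this
  have hinj := Nat.pow_right_injective hL this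
  exact Nat.eq_of_mul_eq_mul_right hd hinj

end EdgeBlocks

section Renormalisation

variable {L : ℕ} (hL : 2 ≤ L) {o : ℕ → Site d} (ho : IsHierOffset L o) (hd : 1 ≤ d)
include hL ho hd

omit ho in
/-- A block of level `m` contained in a block of level `n` has `m ≤ n`. [cite: Hutchcroft2022, §2.1 (p. 6)] -/
theorem level_le_of_block_subset {m n : ℕ} {x y : Site d} (h : block L o m y ⊆ block L o n x) : m ≤ n := by
  have hL1 : 1 ≤ L := le_trans (by norm_num) hL
  have := Finset.card_le_card h
  rw [card_block o, card_block o, ← pow_mul, ← pow_mul] at this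
  have := (Nat.pow_le_pow_iff_right hL).1 this
  exact Nat.le_of_mul_le_mul_right this hd

/-- **The basic renormalisation identity (2.4), as a statement about selections**: a pair's block
is not a strict ancestor of `B_{n+1}(x)` iff it is not a strict ancestor of `B_n(x)` or it is the
block `B_{n+1}(x)` itself (at level `n+1`): "`η_{σ(B)} = η_B ∪ ω_{σ(B)}`".
[cite: Hutchcroft2022, §2.1 (2.4)] -/
theorem mem_aboveFree_succ_iff (n : ℕ) (x : Site d) (e : Sym2 (Site d)) :
    e ∈ aboveFree L o (block L o (n + 1) x) ↔
      e ∈ aboveFree L o (block L o n x) ∨ e ∈ blockEdges L o (n + 1) x := by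
  have hL1 : 1 ≤ L := le_trans (by norm_num) hL
  simp only [aboveFree, blockEdges, Set.mem_setOf_eq]
  by_cases hprop : IsProperEdge L o e
  swap
  · -- improper pairs have empty block, which is no strict superset of a (nonempty) block
    have hE : edgeBlock L o e = ∅ := by rw [edgeBlock, if_neg hprop]
    have hns : ∀ (k : ℕ) (y : Site d), ¬(block L o k y ⊂ (∅ : Finset (Site d))) := fun k y h =>
      Finset.notMem_empty y (h.1 (mem_block_self hL1 o k y))
    simp only [hE, hprop, false_and, or_false]
    exact iff_of_true (hns _ _) (hns _ _)
  · induction e using Sym2.ind with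
    | h a b =>
      have hE := edgeBlock_mk hL ho hprop
      obtain ⟨hlev, h1⟩ := edgeLevel_mk hL ho hprop
      set m := hLevel L o a b with hm
      rw [hE, hlev]
      simp only [hprop, true_and]
      -- `E = B_m(a)` versus `B_{n+1}(x)` and `B_n(x)`: nested or disjoint
      constructor
      · intro hns
        -- `¬ B_{n+1} ⊂ E`: so `E ⊆ B_{n+1}` or disjoint (nested-or-disjoint)
        by_cases hmn : m ≤ n
        · left
          rcases block_subset_or_disjoint hL1 o ho hmn x a with h | h
          · exact fun hss => (Finset.ssubset_iff_subset_ne.1 hss).2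
              (Finset.Subset.antisymm (Finset.ssubset_iff_subset_ne.1 hss).1 h)
          · intro hss
            have hsub := (Finset.ssubset_iff_subset_ne.1 hss).1
            exact Finset.disjoint_left.1 h (hsub (mem_block_self hL1 o n x)) (mem_block_self hL1 o n x)
        · push Not at hmn
          -- `m ≥ n+1`: `B_{n+1} ⊆ E` or disjoint
          rcases block_subset_or_disjoint hL1 o ho (show n + 1 ≤ m by omega) a x with h | h
          · -- `B_{n+1} ⊆ E` and not strictly: equal, hence `m = n+1`
            right
            have heq : block L o (n + 1) x = block L o m a := by
              by_contra hne
              exact hns (Finset.ssubset_iff_subset_ne.2 ⟨h, hne⟩)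
            exact ⟨heq.symm, (level_eq_of_block_eq hL hd heq.symm)⟩
          · left
            intro hss
            have hsub := (Finset.ssubset_iff_subset_ne.1 hss).1
            have hxE : x ∈ block L o m a := hsub (mem_block_self hL1 o n x)
            have hxB : x ∈ block L o (n + 1) x := mem_block_self hL1 o (n + 1) x
            exact Finset.disjoint_left.1 h hxB hxE
      · rintro (hns | ⟨heq, hmeq⟩)
        · -- `¬ B_n ⊂ E` implies `¬ B_{n+1} ⊂ E`
          intro hss
          apply hns
          refine Finset.ssubset_iff_subset_ne.2 ⟨(block_subset_block_succ hL1 o ho n x).trans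
            (Finset.ssubset_iff_subset_ne.1 hss).1, fun heq => ?_⟩
          -- `B_n = E` would give `B_{n+1} ⊂ B_n`
          rw [← heq] at hss
          exact absurd (Finset.card_lt_card hss) (not_lt.2 (Finset.card_le_card (block_subset_block_succ hL1 o ho n x)))
        · rw [heq]
          exact fun hss => (Finset.ssubset_iff_subset_ne.1 hss).2 rfl

end Renormalisation

section EtaIdentity

variable {L : ℕ} (hL : 2 ≤ L) {o : ℕ → Site d} (ho : IsHierOffset L o) (hd : 1 ≤ d)

/-- **The layer of a block**: `ω_B = {e : the hierarchical copy of e is open and e is a pair of B}`.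
[cite: Hutchcroft2022, §2.1 (p. 7, ω_B)] -/
def omegaLayer (S : Set (Sym2 (Site d))) (ξ : Set (Sym2 (Site d) × Fin 2)) : BondConfig (Site d) :=
  {e | (e, (1 : Fin 2)) ∈ ξ ∧ e ∈ S}

include hL ho hd in
/-- **(2.4) `η_{σ(B)} = η_B ∪ ω_{σ(B)}`** for `B = B_n(x)`, `σ(B) = B_{n+1}(x)`, realised on the
labelled configuration `ξ`. [cite: Hutchcroft2022, §2.1 (2.4)] -/
theorem etaCfg_aboveFree_succ (n : ℕ) (x : Site d) (ξ : Set (Sym2 (Site d) × Fin 2)) :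
    etaCfg (aboveFree L o (block L o (n + 1) x)) ξ =
      etaCfg (aboveFree L o (block L o n x)) ξ ∪ omegaLayer (blockEdges L o (n + 1) x) ξ := by
  ext e
  simp only [etaCfg, omegaLayer, Set.mem_setOf_eq, Set.mem_union, mem_aboveFree_succ_iff hL ho hd]
  tauto

end EtaIdentity


end Literature.Probability.Percolation

end
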